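/-
Copyright (c) 2026 the pub-hodgecm-mathlib formalisation cell (harness21).  Prover seat hodgecm-mathlib-F0P3b-p01 (g19): ROAD «N8-INNER» (dealer LH2-plan (g1)), brick E3
«EP ASSEMBLY = H-S4′» (holder LH3-p04 (g7)), co-hand slice (c1)(c2) «ORBIT CONGRUENCE + ADDITIVITY», 2026-09-02.
-/
import Literature.NumberTheory.Rogawski1990.ArchBouazizStableFamilyLinear       -- ★ (S-lin) LH3-p02 (g5): generic `integrable_descConj_of_uniformlyProper`, `descConj_add ∕ _sum ∕ _neg ∕ _const_smul`
import Literature.NumberTheory.Automorphic.ArchInnerFormChartOrbitalSmooth        -- ★ `uniformlyProper_gprimeTorus_chartTorusG_regG`; brings ★ `chartOrbG ∕ chartOrbG_def ∕ chartOrbG_zero ∕ chartQuotientMeasureG`, ★ `orbFamG`, ★ `orbFamGExt`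
import Literature.NumberTheory.Rogawski1990.ArchStableSumGClassSum               -- ★ (2) LH10-p02 (g9): `stableSumG`, `stableSumG_apply`, `stableSumG_eq_archRG_mul_sum`; brings ★ `partnerPerms ∕ slotPerm ∕ slotPerm_mem_regG_iff`
import HarnessLib

/-!
# ORBIT CONGRUENCE and ADDITIVITY of the chart orbital functional `chartOrbG` and of the families `orbFamG`, `orbFamGExt`, `stableSumG (orbFamGExt …)` on `G′_∞ = U(diag α)(L⁺ ⊗ ℝ)`
# (Rogawski 1990 §8.2–8.3, §4.1 (4.1.1); Shelstad 1979 §4; Bouaziz 1994 §3.1, §6.2; Deitmar–Echterhoff 2014 Lemma 9.3.3, Thm. 1.5.3)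

Topic `NumberTheory/Rogawski1990`; namespace `Literature.NumberTheory.Rogawski1990`.  THEOREMS ONLY (no `def`, no instance, no notation, no axiom, no named fact, no `sorry`).
Cell `pub/hodgecm-mathlib`, crux H413 (`stmt-HodgeConjecture-24833`), line LH2 (closer stub `stub_N8`, organ (Sh)′ «inner archimedean transfer»), N8-INNER ROAD B «EP road»
(dealer LH2-plan (g1)), brick (12′)∕E3 «EP ASSEMBLY = H-S4′» (holder LH3-p04 (g7), CENSUS-E3 v1 4ea0a828), co-hand slice **(c1)(c2)** carved 2026-09-02T17:10:40Z for F0P3b-p01 (g19).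
The `G′`-twin of ★ (S-lin) `ArchBouazizStableFamilyLinear` (LH3-p02 (g5): `chartOrbH_add_of_mem_regS`, `stOrbFamH_finset_sum_of_mem_regS`, …), written over the SAME generic
tools (`descConj_add ∕ _sum`, `integrable_descConj_of_uniformlyProper`) and ★ Harish-Chandra's compactness lemma for the `G′`-atlas on the regular set (★
`uniformlyProper_gprimeTorus_chartTorusG_regG`).  Count-neutral.

THE POINT.  E3 localises the test function on the `α`-side by a class partition of unity (`a′ = Σ_J a′_J`) and builds the `β`-side function as a SUM `f := Σ_J f_J` of per-ball
tensors; junk labels are killed because the relevant one-place factor VANISHES ON THE CONJUGACY CLASS of the chart point.  Both moves are instances of two elementary facts about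
the chart orbital functional `chartOrbG L α ν′ S′ a′ c = dt′(B′) · ∫_{G′_∞ ⧸ T_{S′}} a′(y · gprimeTorus α S′ c · y⁻¹)` (★ `chartOrbG_def`):
* §1 **(c1) ORBIT CONGRUENCE** (every label `S′`, every coordinate `c`, every measure): two test functions that AGREE ON THE CONJUGACY CLASS of `gprimeTorus L α S′ c` have the same
  `chartOrbG … c` (`chartOrbG_congr_of_forall_conj`; ★ `descConj_mk`), hence the same `orbFamG … S′ c` (`orbFamG_congr_of_forall_conj`), and — at a `G`-regular point, where the
  wall-extended family IS the raw one (★ `orbFamGExt_of_mem_regG`) — the same `orbFamGExt … S′ c`; agreement on the classes of ALL partner points `gprimeTorus L α S′ (slotPerm ρ c)`,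
  `ρ ∈ partnerPerms S′`, gives the same STABLE sum (`stableSumG_orbFamGExt_congr_of_forall_conj`).  VANISHING corollaries: a test function vanishing on the class (resp. whose
  topological support misses the class) has `chartOrbG = 0`, `orbFamG = 0`, `orbFamGExt = 0` on `RegG`, `stableSumG (orbFamGExt …) = 0` on `RegG` — the junk-label clause of E3a.
* §2 **(c2) ADDITIVITY** at the `G`-regular points of an admissible label (`S′ ⊆ splitChartPlaces`, `α i ≠ 0`) for CONTINUOUS COMPACTLY SUPPORTED test functions: the quotient
  orbital integrand is integrable there (`integrable_descConj_gprimeTorus_of_mem_regG` — ★ HC compactness lemma + ★ `integrable_descConj_of_uniformlyProper`, the quotient measure ★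
  `chartQuotientMeasureG` being Radon), so `chartOrbG_add_of_mem_regG`, `chartOrbG_finset_sum_of_mem_regG`; `chartOrbG_const_smul ∕ _neg` (every `c`); the readers
  `orbFamG_add_of_mem_regG ∕ _finset_sum_…` and `orbFamGExt_add_of_mem_regG ∕ _finset_sum_…` on EVERY label (junk labels: `0 = 0 + 0`), and the STABLE readers
  **`stableSumG_orbFamGExt_add`**, **`stableSumG_orbFamGExt_finset_sum`**, `stableSumG_orbFamGExt_neg ∕ _sub` at every `c ∈ RegG S′` (partner points of a regular point are regular, ★
  `slotPerm_mem_regG_iff`) — «`SS_β` is additive in the test function».  §3 restates the stable sum on `RegG` as `archRG S′ c · Σ_ρ chartOrbG … (slotPerm ρ c)` (★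
  `stableSumG_eq_archRG_mul_sum`), the class-sum currency in which E3 reads both sides; §4 types E3-SUM's binder `hAdd` (`stableSurjG_of_ballTransfer`, LH3-p04 (g7)) TOKEN FOR TOKEN over ★ `ArchSmooth`:
  **`stableSumG_orbFamGExt_finset_sum_of_archSmooth (hα) : ∀ {ι : Type} (s : Finset ι) (f : ι → G′_∞ → ℂ), (∀ i ∈ s, ArchSmooth L 3 (diagonal α) (f i)) → ∀ S c, c ∈ RegG S → SS(Σ f) = Σ SS(f i)`**.
HONEST LABEL: (Sh)′ ∕ row `stub_N8` stay PRINT-labelled until E3 and its binders are ★ and ED. 43 re-keys 27456; HC_CM is proved only modulo the 7 printed citations (2 remaining: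
hLiu418 = stmt-HodgeConjecture-24832, h413 = stmt-HodgeConjecture-24833) until rung 0 closes; this file is measure bookkeeping and pays nothing by itself.

## References
* [Rogawski1990] J. D. Rogawski, *Automorphic Representations of Unitary Groups in Three Variables*, Ann. of Math. Stud. 123 (1990), §4.1 (4.1.1) p. 39, §8.2 p. 122, §8.3 p. 122.
* [Shelstad1979] D. Shelstad, *Characters and inner forms of a quasi-split group over ℝ*, Compositio Math. 39 (1979), §4 p. 22, Lemma 4.2 p. 23.
* [Bouaziz1994IntegralesOrbitales] A. Bouaziz, *Intégrales orbitales sur les groupes de Lie réductifs*, Ann. Sci. ÉNS (4) 27 (1994), §3.1 p. 579 (`J_G` linear), §6.2 p. 591.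
* [DeitmarEchterhoff2014] A. Deitmar, S. Echterhoff, *Principles of Harmonic Analysis*, 2nd ed. (2014), Lemma 9.3.3, Thm. 1.5.3.
* [HarishChandra1970] Harish-Chandra (notes by G. van Dijk), *Harmonic Analysis on Reductive p-adic Groups*, LNM 162 (1970), Part I §3 Lemma 22.
-/

set_option autoImplicit false

noncomputable section

open Set Function MeasureTheory MeasureTheory.Measure NumberField NumberField.InfinitePlace
open scoped Classical
open Literature.NumberTheory.Automorphic Literature.NumberTheory.Automorphic.UnitaryGroup Literature.NumberTheory.Automorphic.ArchCartan
open Literature.MeasureTheory.Group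

namespace Literature.NumberTheory.Rogawski1990

/-! ## §1 (c1) ORBIT CONGRUENCE — every label, every coordinate, every measure -/

section Congr

variable (L : Type) [Field L] [NumberField L] [IsCMField L] (α : Fin 3 → L)
  [MeasurableSpace ↥(arch (↥(maximalRealSubfield L)) L (IsCMField.complexConj L) 3 (Matrix.diagonal α))] [BorelSpace ↥(arch (↥(maximalRealSubfield L)) L (IsCMField.complexConj L) 3 (Matrix.diagonal α))]
  (ν' : Measure ↥(arch (↥(maximalRealSubfield L)) L (IsCMField.complexConj L) 3 (Matrix.diagonal α))) [IsFiniteMeasureOnCompacts ν'] [ν'.IsMulRightInvariant]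
  (S' : Finset {w : InfinitePlace L // IsComplex w})

/-- **(c1) ORBIT CONGRUENCE FOR `chartOrbG`**: two test functions that agree on the conjugacy class `{y · gprimeTorus α S′ c · y⁻¹}` of the chart point have the same chart orbital
functional at `c` — for EVERY label and coordinate (the quotient integrands agree coset by coset, ★ `descConj_mk`). [cite: Rogawski1990, §8.2 p. 122] [cite: Shelstad1979, §4 p. 22] -/
theorem chartOrbG_congr_of_forall_conj {f g : ↥(arch (↥(maximalRealSubfield L)) L (IsCMField.complexConj L) 3 (Matrix.diagonal α)) → ℂ}
    {c : {w : InfinitePlace L // IsComplex w} → Fin 3 → ℝ}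
    (h : ∀ y : ↥(arch (↥(maximalRealSubfield L)) L (IsCMField.complexConj L) 3 (Matrix.diagonal α)), f (y * gprimeTorus L α S' c * y⁻¹) = g (y * gprimeTorus L α S' c * y⁻¹)) :
    chartOrbG L α ν' S' f c = chartOrbG L α ν' S' g c := by
  rw [chartOrbG_def, chartOrbG_def]
  have hint : descConj (gprimeTorus L α S' c) (chartTorusG L α S') (forall_mem_chartTorusG_comm L α S' c) f =
      descConj (gprimeTorus L α S' c) (chartTorusG L α S') (forall_mem_chartTorusG_comm L α S' c) g := by
    funext y
    induction y using QuotientGroup.induction_on with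
    | H x => rw [descConj_mk, descConj_mk, h]
  rw [hint]

/-- **VANISHING**: a test function that vanishes on the conjugacy class of the chart point has `chartOrbG … c = 0` (every label, every `c`). [cite: Rogawski1990, §8.2 p. 122] -/
theorem chartOrbG_eq_zero_of_forall_conj {f : ↥(arch (↥(maximalRealSubfield L)) L (IsCMField.complexConj L) 3 (Matrix.diagonal α)) → ℂ}
    {c : {w : InfinitePlace L // IsComplex w} → Fin 3 → ℝ}
    (h : ∀ y : ↥(arch (↥(maximalRealSubfield L)) L (IsCMField.complexConj L) 3 (Matrix.diagonal α)), f (y * gprimeTorus L α S' c * y⁻¹) = 0) :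
    chartOrbG L α ν' S' f c = 0 := by
  rw [chartOrbG_congr_of_forall_conj L α ν' S' (g := 0) (fun y => by rw [h y, Pi.zero_apply]), chartOrbG_zero]

/-- **VANISHING, SUPPORT FORM**: if no conjugate of the chart point meets the topological support of the test function, `chartOrbG … c = 0` (every label, every `c`).
[cite: Rogawski1990, §8.2 p. 122] [cite: Bouaziz1994IntegralesOrbitales, §3.1 p. 579] -/
theorem chartOrbG_eq_zero_of_forall_conj_not_mem_tsupport {f : ↥(arch (↥(maximalRealSubfield L)) L (IsCMField.complexConj L) 3 (Matrix.diagonal α)) → ℂ}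
    {c : {w : InfinitePlace L // IsComplex w} → Fin 3 → ℝ}
    (h : ∀ y : ↥(arch (↥(maximalRealSubfield L)) L (IsCMField.complexConj L) 3 (Matrix.diagonal α)), y * gprimeTorus L α S' c * y⁻¹ ∉ tsupport f) :
    chartOrbG L α ν' S' f c = 0 :=
  chartOrbG_eq_zero_of_forall_conj L α ν' S' fun y => image_eq_zero_of_notMem_tsupport (h y)

/-- **(c1) FOR THE ORDINARY FAMILY `orbFamG`** (every label: on an admissible label by `chartOrbG_congr_of_forall_conj`, on a junk label both sides vanish).
[cite: Shelstad1979, §4 p. 22] [cite: Rogawski1990, §8.2 p. 122] -/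
theorem orbFamG_congr_of_forall_conj {f g : ↥(arch (↥(maximalRealSubfield L)) L (IsCMField.complexConj L) 3 (Matrix.diagonal α)) → ℂ}
    {c : {w : InfinitePlace L // IsComplex w} → Fin 3 → ℝ}
    (h : ∀ y : ↥(arch (↥(maximalRealSubfield L)) L (IsCMField.complexConj L) 3 (Matrix.diagonal α)), f (y * gprimeTorus L α S' c * y⁻¹) = g (y * gprimeTorus L α S' c * y⁻¹)) :
    orbFamG L α ν' f S' c = orbFamG L α ν' g S' c := by
  by_cases hS' : ∀ w, w ∈ S' → w ∈ splitChartPlaces L α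
  · rw [orbFamG_apply L α ν' f hS', orbFamG_apply L α ν' g hS', chartOrbG_congr_of_forall_conj L α ν' S' h]
  · rw [orbFamG_of_not L α ν' f hS', orbFamG_of_not L α ν' g hS']

/-- `orbFamG … S′ c = 0` when the test function vanishes on the class of the chart point (every label, every `c`). [cite: Shelstad1979, §4 p. 22] -/
theorem orbFamG_eq_zero_of_forall_conj {f : ↥(arch (↥(maximalRealSubfield L)) L (IsCMField.complexConj L) 3 (Matrix.diagonal α)) → ℂ}
    {c : {w : InfinitePlace L // IsComplex w} → Fin 3 → ℝ}
    (h : ∀ y : ↥(arch (↥(maximalRealSubfield L)) L (IsCMField.complexConj L) 3 (Matrix.diagonal α)), f (y * gprimeTorus L α S' c * y⁻¹) = 0) :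
    orbFamG L α ν' f S' c = 0 := by
  have h0 := orbFamG_congr_of_forall_conj L α ν' S' (f := f) (g := 0) (c := c) (fun y => by rw [h y, Pi.zero_apply])
  rw [h0, orbFamG_zero]

/-- **(c1) FOR THE WALL-EXTENDED FAMILY `orbFamGExt` AT A `G`-REGULAR POINT** (there the extended family is the raw one, ★ `orbFamGExt_of_mem_regG`; off `RegG S′` the values are limits
along OTHER classes and no pointwise congruence is claimed). [cite: Shelstad1979, §4 p. 22] [cite: Bouaziz1994IntegralesOrbitales, §6.2 p. 591] -/
theorem orbFamGExt_congr_of_forall_conj_of_mem_regG {f g : ↥(arch (↥(maximalRealSubfield L)) L (IsCMField.complexConj L) 3 (Matrix.diagonal α)) → ℂ}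
    {c : {w : InfinitePlace L // IsComplex w} → Fin 3 → ℝ} (hc : c ∈ RegG S')
    (h : ∀ y : ↥(arch (↥(maximalRealSubfield L)) L (IsCMField.complexConj L) 3 (Matrix.diagonal α)), f (y * gprimeTorus L α S' c * y⁻¹) = g (y * gprimeTorus L α S' c * y⁻¹)) :
    orbFamGExt L α ν' f S' c = orbFamGExt L α ν' g S' c := by
  rw [orbFamGExt_of_mem_regG L α ν' f S' hc, orbFamGExt_of_mem_regG L α ν' g S' hc, orbFamG_congr_of_forall_conj L α ν' S' h]

/-- `orbFamGExt … S′ c = 0` at a `G`-regular point when the test function vanishes on the class of the chart point. [cite: Shelstad1979, §4 p. 22] -/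
theorem orbFamGExt_eq_zero_of_forall_conj_of_mem_regG {f : ↥(arch (↥(maximalRealSubfield L)) L (IsCMField.complexConj L) 3 (Matrix.diagonal α)) → ℂ}
    {c : {w : InfinitePlace L // IsComplex w} → Fin 3 → ℝ} (hc : c ∈ RegG S')
    (h : ∀ y : ↥(arch (↥(maximalRealSubfield L)) L (IsCMField.complexConj L) 3 (Matrix.diagonal α)), f (y * gprimeTorus L α S' c * y⁻¹) = 0) :
    orbFamGExt L α ν' f S' c = 0 := by
  rw [orbFamGExt_of_mem_regG L α ν' f S' hc, orbFamG_eq_zero_of_forall_conj L α ν' S' h]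

/-- **(c1) FOR THE STABLE SUM `stableSumG (orbFamGExt …)` AT A `G`-REGULAR POINT**: if `f` and `g` agree on the conjugacy classes of ALL partner points `gprimeTorus α S′ (slotPerm ρ c)`,
`ρ ∈ partnerPerms S′` (the `G′_∞`-classes inside the stable class), the stable sums agree at `c` (each partner point is `G`-regular, ★ `slotPerm_mem_regG_iff`).
[cite: Shelstad1979, Lemma 4.2 p. 23] [cite: Bouaziz1994IntegralesOrbitales, §6.2 p. 591] [cite: Rogawski1990, §4.1 (4.1.1) p. 39] -/
theorem stableSumG_orbFamGExt_congr_of_forall_conj {f g : ↥(arch (↥(maximalRealSubfield L)) L (IsCMField.complexConj L) 3 (Matrix.diagonal α)) → ℂ}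
    {c : {w : InfinitePlace L // IsComplex w} → Fin 3 → ℝ} (hc : c ∈ RegG S')
    (h : ∀ ρ ∈ partnerPerms S', ∀ y : ↥(arch (↥(maximalRealSubfield L)) L (IsCMField.complexConj L) 3 (Matrix.diagonal α)),
      f (y * gprimeTorus L α S' (slotPerm ρ c) * y⁻¹) = g (y * gprimeTorus L α S' (slotPerm ρ c) * y⁻¹)) :
    stableSumG (orbFamGExt L α ν' f) S' c = stableSumG (orbFamGExt L α ν' g) S' c :=
  stableSumG_congr_of_forall fun ρ hρ => orbFamGExt_congr_of_forall_conj_of_mem_regG L α ν' S' ((slotPerm_mem_regG_iff hρ c).2 hc) (h ρ hρ)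

/-- **THE JUNK-LABEL CLAUSE, ORBITAL FORM**: if `f` vanishes on the conjugacy class of every partner point of the `G`-regular point `c`, then `stableSumG (orbFamGExt L α ν′ f) S′ c = 0`.
[cite: Shelstad1979, Lemma 4.2 p. 23] [cite: Bouaziz1994IntegralesOrbitales, §6.2 p. 591] -/
theorem stableSumG_orbFamGExt_eq_zero_of_forall_conj {f : ↥(arch (↥(maximalRealSubfield L)) L (IsCMField.complexConj L) 3 (Matrix.diagonal α)) → ℂ}
    {c : {w : InfinitePlace L // IsComplex w} → Fin 3 → ℝ} (hc : c ∈ RegG S')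
    (h : ∀ ρ ∈ partnerPerms S', ∀ y : ↥(arch (↥(maximalRealSubfield L)) L (IsCMField.complexConj L) 3 (Matrix.diagonal α)), f (y * gprimeTorus L α S' (slotPerm ρ c) * y⁻¹) = 0) :
    stableSumG (orbFamGExt L α ν' f) S' c = 0 := by
  rw [stableSumG_apply]
  exact Finset.sum_eq_zero fun ρ hρ => by
    rw [orbFamGExt_eq_zero_of_forall_conj_of_mem_regG L α ν' S' ((slotPerm_mem_regG_iff hρ c).2 hc) (h ρ hρ), mul_zero]

/-- **THE JUNK-LABEL CLAUSE, SUPPORT FORM**: if no conjugate of any partner point of the `G`-regular point `c` meets `tsupport f`, then `stableSumG (orbFamGExt L α ν′ f) S′ c = 0`.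
[cite: Shelstad1979, Lemma 4.2 p. 23] [cite: Bouaziz1994IntegralesOrbitales, §3.1 p. 579] -/
theorem stableSumG_orbFamGExt_eq_zero_of_forall_conj_not_mem_tsupport {f : ↥(arch (↥(maximalRealSubfield L)) L (IsCMField.complexConj L) 3 (Matrix.diagonal α)) → ℂ}
    {c : {w : InfinitePlace L // IsComplex w} → Fin 3 → ℝ} (hc : c ∈ RegG S')
    (h : ∀ ρ ∈ partnerPerms S', ∀ y : ↥(arch (↥(maximalRealSubfield L)) L (IsCMField.complexConj L) 3 (Matrix.diagonal α)), y * gprimeTorus L α S' (slotPerm ρ c) * y⁻¹ ∉ tsupport f) :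
    stableSumG (orbFamGExt L α ν' f) S' c = 0 :=
  stableSumG_orbFamGExt_eq_zero_of_forall_conj L α ν' S' hc fun ρ hρ y => image_eq_zero_of_notMem_tsupport (h ρ hρ y)

end Congr

/-! ## §2 (c2) ADDITIVITY in the test function at the `G`-regular points -/

section Add

variable (L : Type) [Field L] [NumberField L] [IsCMField L] (α : Fin 3 → L)
  [MeasurableSpace ↥(arch (↥(maximalRealSubfield L)) L (IsCMField.complexConj L) 3 (Matrix.diagonal α))] [BorelSpace ↥(arch (↥(maximalRealSubfield L)) L (IsCMField.complexConj L) 3 (Matrix.diagonal α))]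
  (ν' : Measure ↥(arch (↥(maximalRealSubfield L)) L (IsCMField.complexConj L) 3 (Matrix.diagonal α))) [IsFiniteMeasureOnCompacts ν'] [ν'.IsMulRightInvariant]

/-- **AT A `G`-REGULAR POINT OF AN ADMISSIBLE LABEL THE QUOTIENT ORBITAL INTEGRAND OF `f ∈ C_c(G′_∞, E)` IS INTEGRABLE** for the chart quotient measure (★ Harish-Chandra's compactness
lemma `uniformlyProper_gprimeTorus_chartTorusG_regG` read at the compact `{c}` through ★ `integrable_descConj_of_uniformlyProper`; ★ `chartQuotientMeasureG` is a Radon measure).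
[cite: Rogawski1990, §8.3 p. 122] [cite: HarishChandra1970, Part I §3 Lemma 22] [cite: DeitmarEchterhoff2014, Lemma 9.3.3; Thm. 1.5.3] -/
theorem integrable_descConj_gprimeTorus_of_mem_regG (hα : ∀ i, α i ≠ 0) {S' : Finset {w : InfinitePlace L // IsComplex w}}
    (hS' : ∀ w, w ∈ S' → w ∈ splitChartPlaces L α) {E : Type*} [NormedAddCommGroup E]
    {f : ↥(arch (↥(maximalRealSubfield L)) L (IsCMField.complexConj L) 3 (Matrix.diagonal α)) → E} (hf : Continuous f) (hfc : HasCompactSupport f)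
    {c : {w : InfinitePlace L // IsComplex w} → Fin 3 → ℝ} (hc : c ∈ RegG S') :
    letI : MeasurableSpace (↥(arch (↥(maximalRealSubfield L)) L (IsCMField.complexConj L) 3 (Matrix.diagonal α)) ⧸ chartTorusG L α S') := borel _
    Integrable (descConj (gprimeTorus L α S' c) (chartTorusG L α S') (forall_mem_chartTorusG_comm L α S' c) f) (chartQuotientMeasureG L α ν' S') := by
  letI : MeasurableSpace (↥(arch (↥(maximalRealSubfield L)) L (IsCMField.complexConj L) 3 (Matrix.diagonal α)) ⧸ chartTorusG L α S') := borel _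
  haveI : BorelSpace (↥(arch (↥(maximalRealSubfield L)) L (IsCMField.complexConj L) 3 (Matrix.diagonal α)) ⧸ chartTorusG L α S') := ⟨rfl⟩
  haveI := locallyCompactSpace_chartTorusG L α S'
  haveI := isHaarMeasure_chartHaarG L α S'
  haveI := isInvInvariant_chartHaarG L α S'
  haveI : IsFiniteMeasureOnCompacts (chartQuotientMeasureG L α ν' S') := by
    unfold chartQuotientMeasureG
    infer_instance
  exact integrable_descConj_of_uniformlyProper (chartTorusG L α S') (forall_mem_chartTorusG_comm L α S') (uniformlyProper_gprimeTorus_chartTorusG_regG L α S' hα hS')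
    (chartQuotientMeasureG L α ν' S') hf hfc hc

/-- **(c2) `chartOrbG` IS ADDITIVE IN THE TEST FUNCTION AT `G`-REGULAR POINTS OF AN ADMISSIBLE LABEL** (`f, g ∈ C_c(G′_∞)`, `c ∈ RegG S′`: both quotient integrands are integrable).
[cite: Rogawski1990, §8.3 p. 122; §4.1 (4.1.1) p. 39] [cite: Bouaziz1994IntegralesOrbitales, §3.1 p. 579] -/
theorem chartOrbG_add_of_mem_regG (hα : ∀ i, α i ≠ 0) {S' : Finset {w : InfinitePlace L // IsComplex w}} (hS' : ∀ w, w ∈ S' → w ∈ splitChartPlaces L α)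
    {f g : ↥(arch (↥(maximalRealSubfield L)) L (IsCMField.complexConj L) 3 (Matrix.diagonal α)) → ℂ}
    (hf : Continuous f) (hfc : HasCompactSupport f) (hg : Continuous g) (hgc : HasCompactSupport g)
    {c : {w : InfinitePlace L // IsComplex w} → Fin 3 → ℝ} (hc : c ∈ RegG S') :
    chartOrbG L α ν' S' (f + g) c = chartOrbG L α ν' S' f c + chartOrbG L α ν' S' g c := by
  have hfi := integrable_descConj_gprimeTorus_of_mem_regG L α ν' hα hS' hf hfc hc
  have hgi := integrable_descConj_gprimeTorus_of_mem_regG L α ν' hα hS' hg hgc hc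
  rw [chartOrbG_def, chartOrbG_def, chartOrbG_def, descConj_add, integral_add' hfi hgi, mul_add]

/-- **`chartOrbG` IS HOMOGENEOUS IN THE TEST FUNCTION** (every label and `c`; no integrability needed). [cite: Rogawski1990, §4.1 (4.1.1) p. 39] -/
theorem chartOrbG_const_smul (S' : Finset {w : InfinitePlace L // IsComplex w})
    (f : ↥(arch (↥(maximalRealSubfield L)) L (IsCMField.complexConj L) 3 (Matrix.diagonal α)) → ℂ) (a : ℂ) (c : {w : InfinitePlace L // IsComplex w} → Fin 3 → ℝ) :
    chartOrbG L α ν' S' (a • f) c = a * chartOrbG L α ν' S' f c := by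
  rw [chartOrbG_def, chartOrbG_def, descConj_const_smul]
  simp_rw [Pi.smul_apply]
  rw [integral_smul, smul_eq_mul]
  ring

/-- **`chartOrbG` IS ODD IN THE TEST FUNCTION** (every label and `c`). [cite: Rogawski1990, §4.1 (4.1.1) p. 39] -/
theorem chartOrbG_neg (S' : Finset {w : InfinitePlace L // IsComplex w})
    (f : ↥(arch (↥(maximalRealSubfield L)) L (IsCMField.complexConj L) 3 (Matrix.diagonal α)) → ℂ) (c : {w : InfinitePlace L // IsComplex w} → Fin 3 → ℝ) :
    chartOrbG L α ν' S' (-f) c = -chartOrbG L α ν' S' f c := by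
  rw [chartOrbG_def, chartOrbG_def, descConj_neg, integral_neg', mul_neg]

/-- `chartOrbG` IS ADDITIVE UNDER SUBTRACTION at `G`-regular points of an admissible label. [cite: Rogawski1990, §4.1 (4.1.1) p. 39] -/
theorem chartOrbG_sub_of_mem_regG (hα : ∀ i, α i ≠ 0) {S' : Finset {w : InfinitePlace L // IsComplex w}} (hS' : ∀ w, w ∈ S' → w ∈ splitChartPlaces L α)
    {f g : ↥(arch (↥(maximalRealSubfield L)) L (IsCMField.complexConj L) 3 (Matrix.diagonal α)) → ℂ}
    (hf : Continuous f) (hfc : HasCompactSupport f) (hg : Continuous g) (hgc : HasCompactSupport g)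
    {c : {w : InfinitePlace L // IsComplex w} → Fin 3 → ℝ} (hc : c ∈ RegG S') :
    chartOrbG L α ν' S' (f - g) c = chartOrbG L α ν' S' f c - chartOrbG L α ν' S' g c := by
  rw [sub_eq_add_neg, chartOrbG_add_of_mem_regG L α ν' hα hS' hf hfc hg.neg hgc.neg hc, chartOrbG_neg, ← sub_eq_add_neg]

/-- **`chartOrbG` IS ADDITIVE OVER FINITE SUMS OF `C_c` TEST FUNCTIONS AT `G`-REGULAR POINTS OF AN ADMISSIBLE LABEL.** [cite: Rogawski1990, §8.3 p. 122; §4.1 (4.1.1) p. 39] -/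
theorem chartOrbG_finset_sum_of_mem_regG (hα : ∀ i, α i ≠ 0) {S' : Finset {w : InfinitePlace L // IsComplex w}} (hS' : ∀ w, w ∈ S' → w ∈ splitChartPlaces L α)
    {ι : Type*} (s : Finset ι) {f : ι → ↥(arch (↥(maximalRealSubfield L)) L (IsCMField.complexConj L) 3 (Matrix.diagonal α)) → ℂ}
    (hf : ∀ i ∈ s, Continuous (f i)) (hfc : ∀ i ∈ s, HasCompactSupport (f i))
    {c : {w : InfinitePlace L // IsComplex w} → Fin 3 → ℝ} (hc : c ∈ RegG S') :
    chartOrbG L α ν' S' (∑ i ∈ s, f i) c = ∑ i ∈ s, chartOrbG L α ν' S' (f i) c := by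
  have hint := fun i (hi : i ∈ s) => integrable_descConj_gprimeTorus_of_mem_regG L α ν' hα hS' (hf i hi) (hfc i hi) hc
  rw [chartOrbG_def, descConj_sum, Finset.sum_fn, integral_finsetSum s hint, Finset.mul_sum]
  exact Finset.sum_congr rfl fun i _ => (chartOrbG_def L α ν' S' (f i) c).symm

/-- **(c2) FOR THE ORDINARY FAMILY `orbFamG` ON EVERY LABEL** at a `G`-regular point (admissible: `R′ · chartOrbG` with `chartOrbG` additive; junk: `0 = 0 + 0`).
[cite: Shelstad1979, §4 p. 22] [cite: Rogawski1990, §8.3 p. 122] -/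
theorem orbFamG_add_of_mem_regG (hα : ∀ i, α i ≠ 0) (S' : Finset {w : InfinitePlace L // IsComplex w})
    {f g : ↥(arch (↥(maximalRealSubfield L)) L (IsCMField.complexConj L) 3 (Matrix.diagonal α)) → ℂ}
    (hf : Continuous f) (hfc : HasCompactSupport f) (hg : Continuous g) (hgc : HasCompactSupport g)
    {c : {w : InfinitePlace L // IsComplex w} → Fin 3 → ℝ} (hc : c ∈ RegG S') :
    orbFamG L α ν' (f + g) S' c = orbFamG L α ν' f S' c + orbFamG L α ν' g S' c := by
  by_cases hS' : ∀ w, w ∈ S' → w ∈ splitChartPlaces L α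
  · rw [orbFamG_apply L α ν' _ hS', orbFamG_apply L α ν' f hS', orbFamG_apply L α ν' g hS', chartOrbG_add_of_mem_regG L α ν' hα hS' hf hfc hg hgc hc, mul_add]
  · rw [orbFamG_of_not L α ν' _ hS', orbFamG_of_not L α ν' f hS', orbFamG_of_not L α ν' g hS', add_zero]

/-- `orbFamG` IS ADDITIVE OVER FINITE SUMS at a `G`-regular point of EVERY label. [cite: Shelstad1979, §4 p. 22] [cite: Rogawski1990, §8.3 p. 122] -/
theorem orbFamG_finset_sum_of_mem_regG (hα : ∀ i, α i ≠ 0) (S' : Finset {w : InfinitePlace L // IsComplex w})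
    {ι : Type*} (s : Finset ι) {f : ι → ↥(arch (↥(maximalRealSubfield L)) L (IsCMField.complexConj L) 3 (Matrix.diagonal α)) → ℂ}
    (hf : ∀ i ∈ s, Continuous (f i)) (hfc : ∀ i ∈ s, HasCompactSupport (f i))
    {c : {w : InfinitePlace L // IsComplex w} → Fin 3 → ℝ} (hc : c ∈ RegG S') :
    orbFamG L α ν' (∑ i ∈ s, f i) S' c = ∑ i ∈ s, orbFamG L α ν' (f i) S' c := by
  by_cases hS' : ∀ w, w ∈ S' → w ∈ splitChartPlaces L α
  · rw [orbFamG_apply L α ν' _ hS', chartOrbG_finset_sum_of_mem_regG L α ν' hα hS' s hf hfc hc, Finset.mul_sum]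
    exact Finset.sum_congr rfl fun i _ => (orbFamG_apply L α ν' (f i) hS' c).symm
  · rw [orbFamG_of_not L α ν' _ hS']
    exact (Finset.sum_eq_zero fun i _ => by rw [orbFamG_of_not L α ν' (f i) hS']).symm

/-- **(c2) FOR THE WALL-EXTENDED FAMILY `orbFamGExt` AT A `G`-REGULAR POINT OF EVERY LABEL** (★ `orbFamGExt_of_mem_regG`: the extended family is the raw one there).
[cite: Shelstad1979, §4 p. 22] [cite: Bouaziz1994IntegralesOrbitales, §3.1 p. 579; §6.2 p. 591] -/
theorem orbFamGExt_add_of_mem_regG (hα : ∀ i, α i ≠ 0) (S' : Finset {w : InfinitePlace L // IsComplex w})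
    {f g : ↥(arch (↥(maximalRealSubfield L)) L (IsCMField.complexConj L) 3 (Matrix.diagonal α)) → ℂ}
    (hf : Continuous f) (hfc : HasCompactSupport f) (hg : Continuous g) (hgc : HasCompactSupport g)
    {c : {w : InfinitePlace L // IsComplex w} → Fin 3 → ℝ} (hc : c ∈ RegG S') :
    orbFamGExt L α ν' (f + g) S' c = orbFamGExt L α ν' f S' c + orbFamGExt L α ν' g S' c := by
  rw [orbFamGExt_of_mem_regG L α ν' _ S' hc, orbFamGExt_of_mem_regG L α ν' f S' hc, orbFamGExt_of_mem_regG L α ν' g S' hc,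
    orbFamG_add_of_mem_regG L α ν' hα S' hf hfc hg hgc hc]

/-- `orbFamGExt` IS ADDITIVE OVER FINITE SUMS at a `G`-regular point of every label. [cite: Shelstad1979, §4 p. 22] [cite: Bouaziz1994IntegralesOrbitales, §6.2 p. 591] -/
theorem orbFamGExt_finset_sum_of_mem_regG (hα : ∀ i, α i ≠ 0) (S' : Finset {w : InfinitePlace L // IsComplex w})
    {ι : Type*} (s : Finset ι) {f : ι → ↥(arch (↥(maximalRealSubfield L)) L (IsCMField.complexConj L) 3 (Matrix.diagonal α)) → ℂ}
    (hf : ∀ i ∈ s, Continuous (f i)) (hfc : ∀ i ∈ s, HasCompactSupport (f i))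
    {c : {w : InfinitePlace L // IsComplex w} → Fin 3 → ℝ} (hc : c ∈ RegG S') :
    orbFamGExt L α ν' (∑ i ∈ s, f i) S' c = ∑ i ∈ s, orbFamGExt L α ν' (f i) S' c := by
  rw [orbFamGExt_of_mem_regG L α ν' _ S' hc, orbFamG_finset_sum_of_mem_regG L α ν' hα S' s hf hfc hc]
  exact Finset.sum_congr rfl fun i _ => (orbFamGExt_of_mem_regG L α ν' (f i) S' hc).symm

/-- **(c2) FOR THE STABLE SUM — «`SS` IS ADDITIVE IN THE TEST FUNCTION»**: `stableSumG (orbFamGExt L α ν′ (f + g)) S′ c = stableSumG (orbFamGExt L α ν′ f) S′ c + stableSumG (orbFamGExt L α ν′ g) S′ c`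
at every `G`-regular point `c` of every label, for `f, g ∈ C_c(G′_∞)` (every partner point `slotPerm ρ c` is `G`-regular, ★ `slotPerm_mem_regG_iff`).
[cite: Shelstad1979, Lemma 4.2 p. 23] [cite: Bouaziz1994IntegralesOrbitales, §6.2 p. 591] [cite: Rogawski1990, §4.1 (4.1.1) p. 39] -/
theorem stableSumG_orbFamGExt_add (hα : ∀ i, α i ≠ 0) (S' : Finset {w : InfinitePlace L // IsComplex w})
    {f g : ↥(arch (↥(maximalRealSubfield L)) L (IsCMField.complexConj L) 3 (Matrix.diagonal α)) → ℂ}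
    (hf : Continuous f) (hfc : HasCompactSupport f) (hg : Continuous g) (hgc : HasCompactSupport g)
    {c : {w : InfinitePlace L // IsComplex w} → Fin 3 → ℝ} (hc : c ∈ RegG S') :
    stableSumG (orbFamGExt L α ν' (f + g)) S' c = stableSumG (orbFamGExt L α ν' f) S' c + stableSumG (orbFamGExt L α ν' g) S' c := by
  rw [stableSumG_apply, stableSumG_apply, stableSumG_apply, ← Finset.sum_add_distrib]
  refine Finset.sum_congr rfl fun ρ hρ => ?_
  rw [orbFamGExt_add_of_mem_regG L α ν' hα S' hf hfc hg hgc ((slotPerm_mem_regG_iff hρ c).2 hc), mul_add]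

/-- **THE STABLE SUM IS ADDITIVE OVER FINITE SUMS OF `C_c` TEST FUNCTIONS** at every `G`-regular point of every label — the form E3 consumes for `f := Σ_J f_J`.
[cite: Shelstad1979, Lemma 4.2 p. 23] [cite: Bouaziz1994IntegralesOrbitales, §6.2 p. 591] -/
theorem stableSumG_orbFamGExt_finset_sum (hα : ∀ i, α i ≠ 0) (S' : Finset {w : InfinitePlace L // IsComplex w})
    {ι : Type*} (s : Finset ι) {f : ι → ↥(arch (↥(maximalRealSubfield L)) L (IsCMField.complexConj L) 3 (Matrix.diagonal α)) → ℂ}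
    (hf : ∀ i ∈ s, Continuous (f i)) (hfc : ∀ i ∈ s, HasCompactSupport (f i))
    {c : {w : InfinitePlace L // IsComplex w} → Fin 3 → ℝ} (hc : c ∈ RegG S') :
    stableSumG (orbFamGExt L α ν' (∑ i ∈ s, f i)) S' c = ∑ i ∈ s, stableSumG (orbFamGExt L α ν' (f i)) S' c := by
  simp only [stableSumG_apply]
  rw [Finset.sum_comm]
  refine Finset.sum_congr rfl fun ρ hρ => ?_
  rw [orbFamGExt_finset_sum_of_mem_regG L α ν' hα S' s hf hfc ((slotPerm_mem_regG_iff hρ c).2 hc), Finset.mul_sum]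

/-- The stable sum is ODD in the test function at a `G`-regular point of every label (no integrability needed). [cite: Shelstad1979, Lemma 4.2 p. 23] -/
theorem stableSumG_orbFamGExt_neg (S' : Finset {w : InfinitePlace L // IsComplex w})
    (f : ↥(arch (↥(maximalRealSubfield L)) L (IsCMField.complexConj L) 3 (Matrix.diagonal α)) → ℂ)
    {c : {w : InfinitePlace L // IsComplex w} → Fin 3 → ℝ} (hc : c ∈ RegG S') :
    stableSumG (orbFamGExt L α ν' (-f)) S' c = -stableSumG (orbFamGExt L α ν' f) S' c := by
  rw [stableSumG_apply, stableSumG_apply, ← Finset.sum_neg_distrib]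
  refine Finset.sum_congr rfl fun ρ hρ => ?_
  have hρc : slotPerm ρ c ∈ RegG S' := (slotPerm_mem_regG_iff hρ c).2 hc
  rw [orbFamGExt_of_mem_regG L α ν' _ S' hρc, orbFamGExt_of_mem_regG L α ν' f S' hρc]
  by_cases hS' : ∀ w, w ∈ S' → w ∈ splitChartPlaces L α
  · rw [orbFamG_apply L α ν' _ hS', orbFamG_apply L α ν' f hS', chartOrbG_neg]
    ring
  · rw [orbFamG_of_not L α ν' _ hS', orbFamG_of_not L α ν' f hS', mul_zero, neg_zero]

/-- The stable sum is ADDITIVE UNDER SUBTRACTION of `C_c` test functions at a `G`-regular point of every label. [cite: Shelstad1979, Lemma 4.2 p. 23] -/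
theorem stableSumG_orbFamGExt_sub (hα : ∀ i, α i ≠ 0) (S' : Finset {w : InfinitePlace L // IsComplex w})
    {f g : ↥(arch (↥(maximalRealSubfield L)) L (IsCMField.complexConj L) 3 (Matrix.diagonal α)) → ℂ}
    (hf : Continuous f) (hfc : HasCompactSupport f) (hg : Continuous g) (hgc : HasCompactSupport g)
    {c : {w : InfinitePlace L // IsComplex w} → Fin 3 → ℝ} (hc : c ∈ RegG S') :
    stableSumG (orbFamGExt L α ν' (f - g)) S' c = stableSumG (orbFamGExt L α ν' f) S' c - stableSumG (orbFamGExt L α ν' g) S' c := by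
  rw [sub_eq_add_neg, stableSumG_orbFamGExt_add L α ν' hα S' hf hfc hg.neg hgc.neg hc, stableSumG_orbFamGExt_neg L α ν' S' g hc, ← sub_eq_add_neg]

end Add

/-! ## §3 The class-sum reading of the stable sum on the regular set -/

section ClassSum

variable (L : Type) [Field L] [NumberField L] [IsCMField L] (α : Fin 3 → L)
  [MeasurableSpace ↥(arch (↥(maximalRealSubfield L)) L (IsCMField.complexConj L) 3 (Matrix.diagonal α))] [BorelSpace ↥(arch (↥(maximalRealSubfield L)) L (IsCMField.complexConj L) 3 (Matrix.diagonal α))]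
  (ν' : Measure ↥(arch (↥(maximalRealSubfield L)) L (IsCMField.complexConj L) 3 (Matrix.diagonal α))) [IsFiniteMeasureOnCompacts ν'] [ν'.IsMulRightInvariant]

/-- **THE STABLE SUM OF THE WALL-EXTENDED FAMILY ON THE REGULAR SET, CLASS-SUM FORM**: for an admissible label `S′` and `c ∈ RegG S′`,
`stableSumG (orbFamGExt L α ν′ f) S′ c = archRG S′ c · Σ_{ρ ∈ partnerPerms S′} chartOrbG L α ν′ S′ f (slotPerm ρ c)` (★ `orbFamGExt_of_mem_regG` + ★ `orbFamG_apply` at the regular partner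
points, ★ `stableSumG_eq_archRG_mul_sum`). [cite: Rogawski1990, §4.1 (4.1.1) p. 39; §4.3 (4.3.1) p. 43] [cite: Shelstad1979, Lemma 4.2 p. 23] -/
theorem stableSumG_orbFamGExt_eq_archRG_mul_sum_chartOrbG {S' : Finset {w : InfinitePlace L // IsComplex w}} (hS' : ∀ w, w ∈ S' → w ∈ splitChartPlaces L α)
    (f : ↥(arch (↥(maximalRealSubfield L)) L (IsCMField.complexConj L) 3 (Matrix.diagonal α)) → ℂ)
    {c : {w : InfinitePlace L // IsComplex w} → Fin 3 → ℝ} (hc : c ∈ RegG S') :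
    stableSumG (orbFamGExt L α ν' f) S' c = archRG S' c * ∑ ρ ∈ partnerPerms S', chartOrbG L α ν' S' f (slotPerm ρ c) :=
  stableSumG_eq_archRG_mul_sum fun ρ hρ => by
    rw [orbFamGExt_of_mem_regG L α ν' f S' ((slotPerm_mem_regG_iff hρ c).2 hc), orbFamG_apply L α ν' f hS']

/-- On a JUNK label (some `w ∈ S′` not a split-chart place) the stable sum of the wall-extended family vanishes identically (★ `orbFamGExt_of_not_admissible`). [cite: Shelstad1979, §4 p. 22] -/
theorem stableSumG_orbFamGExt_of_not_admissible {S' : Finset {w : InfinitePlace L // IsComplex w}} (hS' : ¬ ∀ w, w ∈ S' → w ∈ splitChartPlaces L α)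
    (f : ↥(arch (↥(maximalRealSubfield L)) L (IsCMField.complexConj L) 3 (Matrix.diagonal α)) → ℂ) (c : {w : InfinitePlace L // IsComplex w} → Fin 3 → ℝ) :
    stableSumG (orbFamGExt L α ν' f) S' c = 0 := by
  rw [stableSumG_apply]
  exact Finset.sum_eq_zero fun ρ _ => by rw [orbFamGExt_of_not_admissible L α ν' f S' hS', mul_zero]

end ClassSum

/-! ## §4 E3-SUM's additivity letter `hAdd`, token for token -/

section Letter

variable (L : Type) [Field L] [NumberField L] [IsCMField L] (α : Fin 3 → L)
  [MeasurableSpace ↥(arch (↥(maximalRealSubfield L)) L (IsCMField.complexConj L) 3 (Matrix.diagonal α))] [BorelSpace ↥(arch (↥(maximalRealSubfield L)) L (IsCMField.complexConj L) 3 (Matrix.diagonal α))]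
  (ν' : Measure ↥(arch (↥(maximalRealSubfield L)) L (IsCMField.complexConj L) 3 (Matrix.diagonal α))) [IsFiniteMeasureOnCompacts ν'] [ν'.IsMulRightInvariant]

/-- **(c2) FOR `C_c^∞` TEST FUNCTIONS, PAIR FORM** (★ `ArchSmooth.continuous ∕ .hasCompactSupport`). [cite: Shelstad1979, Lemma 4.2 p. 23] [cite: Bouaziz1994IntegralesOrbitales, §6.2 p. 591] -/
theorem stableSumG_orbFamGExt_add_of_archSmooth (hα : ∀ i, α i ≠ 0) (S' : Finset {w : InfinitePlace L // IsComplex w})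
    {f g : ↥(arch (↥(maximalRealSubfield L)) L (IsCMField.complexConj L) 3 (Matrix.diagonal α)) → ℂ}
    (hf : ArchSmooth L 3 (Matrix.diagonal α) f) (hg : ArchSmooth L 3 (Matrix.diagonal α) g)
    {c : {w : InfinitePlace L // IsComplex w} → Fin 3 → ℝ} (hc : c ∈ RegG S') :
    stableSumG (orbFamGExt L α ν' (f + g)) S' c = stableSumG (orbFamGExt L α ν' f) S' c + stableSumG (orbFamGExt L α ν' g) S' c :=
  stableSumG_orbFamGExt_add L α ν' hα S' hf.continuous hf.hasCompactSupport hg.continuous hg.hasCompactSupport hc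

/-- **THE `hAdd` BINDER OF ★-to-be E3-SUM `stableSurjG_of_ballTransfer` (LH3-p04 (g7)), TOKEN FOR TOKEN** — «`f ↦ SS(f)` is additive over finite sums of `C_c^∞` test functions on every
`RegG S`»: for `β` with `β i ≠ 0`, `hAdd := stableSumG_orbFamGExt_finset_sum_of_archSmooth L β νβ hβ`. [cite: Shelstad1979, Lemma 4.2 p. 23] [cite: Bouaziz1994IntegralesOrbitales, §6.2 p. 591]
[cite: Rogawski1990, §4.1 (4.1.1) p. 39] -/
theorem stableSumG_orbFamGExt_finset_sum_of_archSmooth (hα : ∀ i, α i ≠ 0) :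
    ∀ {ι : Type} (s : Finset ι) (f : ι → ↥(arch (↥(maximalRealSubfield L)) L (IsCMField.complexConj L) 3 (Matrix.diagonal α)) → ℂ),
      (∀ i ∈ s, ArchSmooth L 3 (Matrix.diagonal α) (f i)) →
      ∀ (S : Finset {w : InfinitePlace L // IsComplex w}) (c : {w : InfinitePlace L // IsComplex w} → Fin 3 → ℝ), c ∈ RegG S →
        stableSumG (orbFamGExt L α ν' (∑ i ∈ s, f i)) S c = ∑ i ∈ s, stableSumG (orbFamGExt L α ν' (f i)) S c :=
  fun s _ hf S _ hc => stableSumG_orbFamGExt_finset_sum L α ν' hα S s (fun i hi => (hf i hi).continuous) (fun i hi => (hf i hi).hasCompactSupport) hc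

/-- The same additivity letter with a universe-polymorphic index type. [cite: Shelstad1979, Lemma 4.2 p. 23] -/
theorem stableSumG_orbFamGExt_finset_sum_of_archSmooth' (hα : ∀ i, α i ≠ 0) {ι : Type*} (s : Finset ι)
    {f : ι → ↥(arch (↥(maximalRealSubfield L)) L (IsCMField.complexConj L) 3 (Matrix.diagonal α)) → ℂ} (hf : ∀ i ∈ s, ArchSmooth L 3 (Matrix.diagonal α) (f i))
    (S : Finset {w : InfinitePlace L // IsComplex w}) {c : {w : InfinitePlace L // IsComplex w} → Fin 3 → ℝ} (hc : c ∈ RegG S) :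
    stableSumG (orbFamGExt L α ν' (∑ i ∈ s, f i)) S c = ∑ i ∈ s, stableSumG (orbFamGExt L α ν' (f i)) S c :=
  stableSumG_orbFamGExt_finset_sum L α ν' hα S s (fun i hi => (hf i hi).continuous) (fun i hi => (hf i hi).hasCompactSupport) hc

end Letter

end Literature.NumberTheory.Rogawski1990

end
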